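import Summits.BirchSwinnertonDyer.BirchSwinnertonDyer.Theses.MordellShaFreeCut
import Literature.NumberTheory.EllipticCurves.DasguptaVoight2018.SylvesterRankOne
import Summits.BirchSwinnertonDyer.BirchSwinnertonDyer.Theorems.MordellShaFreeCutRungDVSquare

set_option linter.dupNamespace false
set_option autoImplicit false

/-! # Route `MordellShaFreeCut` (rung S2b) — definitions the route posits for crux
`RankPosOfThreeSelmerCorankOne` (stmt-BirchSwinnertonDyer-19159, the route's declared RESIDUAL): the
Dasgupta–Voight square family `F²`, the rung Prop on `F²` and its s-case Prop (tribunal identifiers)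

The rung of the residual crux A on `F²` is LANDED def-free in
`Theorems/MordellShaFreeCutRungDVSquare.lean` (`rung_dvSquare`, modulo the refereed fact
`DasguptaVoight2018.thm2_mordellWeilRank_eq_one_cubeSum_prime_and_sq` = Dasgupta–Voight, Proc. AMS
146 (2018) Thm. 2). The tribunal kernel consumes a rung as IDENTIFIERS — `--witness <fq theorem>` and
`--s-case <decl stating the S-restricted case>` (precedents on this route: crux B's
`…Theorems.MordellShaFreeCutRungSupersingular.stub_rung_supersingular` with s-case
`BurungaleKobayashiOta2024.thm15_…`; on the sibling route S2, `CongruentShaFreeCutDefs.lean` for the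
Monsky family `W`). This file supplies those identifiers for `F²` in the shapes of the sibling file:
* `IsDVSquareFamily D` — `D = −432 p⁴` with `p` prime, `p ≡ 4, 7 (mod 9)` and `3` not a cube modulo
  `p`: the Weierstrass models `y² = x³ − 432 (p²)²` of `x³ + y³ = p²` on which Dasgupta–Voight prove
  `rank = 1` by mock Heegner points, and on which NO refereed statement gives `ord_{s=1} L = 1`
  (Hu–Shu–Yin 2019 Thm. 1.3/1.5 treat `E_p` only; Yin, Trans. AMS 375 (2022) the class `8 (mod 9)`;
  Shu–Yin, Math. Ann. 385 (2023) the classes `2, 5 (mod 9)`; Yin's 2026 preprints CLAIM it).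
  Members: `p = 7, 13, 31, 43, 79, 97, 139, 157, …` (Dasgupta–Voight §5.3, Table 2).
* `RankPosOnDVSquareFamily` — crux A VERBATIM restricted to `F²` (the WITNESS statement; proved
  here modulo the DV fact: `rankPosOnDVSquareFamily_of_dv`, and a literal consequence of the crux:
  `rankPosOnDVSquareFamily_of_crux`).
* `AnalyticRankOneOnDVSquareFamily` — the rung-leaf `rankOne_threeConverse_mordellCurve` restricted
  to `F²` (the S-CASE; a literal consequence of the leaf: `analyticRankOneOnDVSquareFamily_of_leaf`;
  in no refereed statement on `F²` — memo `HOME/bsd-cn100-s2b-c3/SEPARATING-19159.md`, with the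
  honest caveat that it is DERIVABLE from DV's non-torsion point and Yuan–Zhang–Zhang's general
  Gross–Zagier formula, though printed nowhere). Its hypothesis-free display
  `AnalyticRankOneOnDVSquareFamily'` implies it outright (`…_of_display`); the converse would need
  `corank_{ℤ₃} Sel_{3^∞}(E_{p²}) = 1` on `F²`, i.e. `#Ш(E_{p²})[3^∞] < ∞`, not in print.
* `analyticRankOneOnDVSquareFamily_of_cruxB_of_dv` — on `F²` the s-case follows from crux B
  (`AnalyticRankOneOfRankOneFiniteShaThree`, the route's ATTACKED conjunct) and the DV fact alone:
  `rank = 1` (DV) and `corank = 1` force `corank Ш[3^∞] = 0` (Greenberg's identity), i.e.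
  `#Ш[3^∞] < ∞`, and B returns `ord L = 1`. So on `F²` the leaf's content is EXACTLY crux B's —
  crux A contributes nothing there, which is the separation in logical form.
Nothing is asserted; no axiom, no instance, no notation; the three closed Props carry `@[conjecture]`
(obligation nodes: the witness is closed modulo the DV fact in this file, the s-case is OPEN in
print). HONEST FRAMING: a closed rung closes nothing of BSD; crux A stays the route's declared
residual.
-/

namespace Summit.BirchSwinnertonDyer.BirchSwinnertonDyer.Theorems.MordellShaFreeCutDefs

open Literature.NumberTheory.EllipticCurves
open Literature.NumberTheory.EllipticCurves.DasguptaVoight2018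
open Summit.BirchSwinnertonDyer.BirchSwinnertonDyer.Theses.MordellShaFreeCut
open WeierstrassCurve

/-- **The Dasgupta–Voight square family `F²`**: `D = −432 p⁴ = −432 (p²)²` with `p` prime,
`p ≡ 4, 7 (mod 9)`, and `3` not a cube modulo `p` (`¬ ∃ x : ZMod p, x³ = 3`) — the tree's models
`mordellCurve D` of `x³ + y³ = p²` in Dasgupta–Voight 2018 Thm. 2. Members: `p = 7, 13, 31, 43, 79, …`. -/
def IsDVSquareFamily (D : ℚ) : Prop :=
  ∃ p : ℕ, p.Prime ∧ (p % 9 = 4 ∨ p % 9 = 7) ∧ (¬ ∃ x : ZMod p, x ^ 3 = 3) ∧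
    D = -(432 * ((p : ℚ) ^ 2) ^ 2)

/-- **The rung statement (WITNESS) for crux A on `F²`**: `RankPosOfThreeSelmerCorankOne` verbatim
with `D` restricted to `IsDVSquareFamily` (the `D ≠ 0` guard of the crux is automatic on `F²`). -/
@[conjecture] def RankPosOnDVSquareFamily : Prop :=
  ∀ ⦃D : ℚ⦄, IsDVSquareFamily D → (mordellCurve D).selmerCorank 3 = 1 →
    1 ≤ (mordellCurve D).mordellWeilRank

/-- **The S-CASE for the rung**: the rung-leaf `rankOne_threeConverse_mordellCurve` (rank-one
`3`-converse, `corank_{ℤ₃} Sel_{3^∞}(E_D) = 1 ⟹ ord_{s=1} L(E_D, s) = 1`) verbatim restricted to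
`F²`. In no refereed statement on `F²` (memo SEPARATING-19159.md, with the derivability caveat) —
typed as a statement only, for `--s-case`. -/
@[conjecture] def AnalyticRankOneOnDVSquareFamily : Prop :=
  ∀ ⦃D : ℚ⦄, IsDVSquareFamily D → (mordellCurve D).selmerCorank 3 = 1 →
    (mordellCurve D).analyticRank = 1

/-- **Hypothesis-free display of the S-case**: `∀ D ∈ F², ord_{s=1} L(E_D, s) = 1` — what
Gross–Zagier-type print would state (`ord L(E_{p²}, s) = 1`); it implies
`AnalyticRankOneOnDVSquareFamily` outright (`analyticRankOneOnDVSquareFamily_of_display`). -/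
@[conjecture] def AnalyticRankOneOnDVSquareFamily' : Prop :=
  ∀ ⦃D : ℚ⦄, IsDVSquareFamily D → (mordellCurve D).analyticRank = 1

namespace IsDVSquareFamily

/-- Members of `F²` are non-zero (so `mordellCurve D` is elliptic and the crux's guard holds). -/
theorem ne_zero {D : ℚ} (h : IsDVSquareFamily D) : D ≠ 0 := by
  obtain ⟨p, hp, -, -, rfl⟩ := h
  have hp0 : (p : ℚ) ≠ 0 := by exact_mod_cast hp.ne_zero
  exact neg_ne_zero.mpr (mul_ne_zero (by norm_num) (pow_ne_zero 2 (pow_ne_zero 2 hp0)))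

/-- Members of `F²` are negative (`D = −432 p⁴ < 0`). -/
theorem neg {D : ℚ} (h : IsDVSquareFamily D) : D < 0 := by
  obtain ⟨p, hp, -, -, rfl⟩ := h
  have hp0 : (0 : ℚ) < p := by exact_mod_cast hp.pos
  have : (0 : ℚ) < 432 * ((p : ℚ) ^ 2) ^ 2 := by positivity
  linarith

/-- **`rank E_D(ℚ) = 1` on `F²`** (Dasgupta–Voight 2018 Thm. 2, second conjunct; modulo `hDV`). -/
theorem mordellWeilRank_eq_one (hDV : thm2_mordellWeilRank_eq_one_cubeSum_prime_and_sq) {D : ℚ}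
    (h : IsDVSquareFamily D) : (mordellCurve D).mordellWeilRank = 1 := by
  obtain ⟨p, hp, h9, h3, rfl⟩ := h
  exact (hDV hp h9 h3).2

/-- `p = 7`: `D = −432·7⁴ ∈ F²` (`7 ≡ 7 (mod 9)`; the cubes mod `7` are `0, ±1`, so `3` is not one). -/
theorem seven : IsDVSquareFamily (-(432 * ((7 : ℚ) ^ 2) ^ 2)) :=
  ⟨7, by norm_num, Or.inr rfl, by decide, by norm_num⟩

/-- `p = 13`: `D = −432·13⁴ ∈ F²` (`13 ≡ 4 (mod 9)`; the cubes mod `13` are `0, ±1, ±5`). -/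
theorem thirteen : IsDVSquareFamily (-(432 * ((13 : ℚ) ^ 2) ^ 2)) :=
  ⟨13, by norm_num, Or.inl rfl, by decide, by norm_num⟩

end IsDVSquareFamily

/-- **The WITNESS, proved**: `RankPosOnDVSquareFamily` modulo the refereed Dasgupta–Voight fact
(`rank = 1` on all of `F²`; the corank clause only restricts the statement). The def-free twin is
`…Theorems.MordellShaFreeCutRungDVSquare.rung_dvSquare`. -/
theorem rankPosOnDVSquareFamily_of_dv (hDV : thm2_mordellWeilRank_eq_one_cubeSum_prime_and_sq) :
    RankPosOnDVSquareFamily :=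
  fun _ hD _ => (hD.mordellWeilRank_eq_one hDV).ge

/-- The witness statement is a LITERAL RESTRICTION of crux A (so it is implied by the crux; pure logic). -/
theorem rankPosOnDVSquareFamily_of_crux (hA : RankPosOfThreeSelmerCorankOne) :
    RankPosOnDVSquareFamily :=
  fun _ hD hc => hA hD.ne_zero hc

/-- The s-case is a LITERAL RESTRICTION of the rung-leaf `rankOne_threeConverse_mordellCurve` (pure
logic; the leaf is the open binder of rung S2b, so this proves nothing about `F²`). -/
theorem analyticRankOneOnDVSquareFamily_of_leaf (hT : rankOne_threeConverse_mordellCurve) :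
    AnalyticRankOneOnDVSquareFamily :=
  fun _ hD hc => hT hD.ne_zero hc

/-- The hypothesis-free display implies the s-case (drop the corank hypothesis). -/
theorem analyticRankOneOnDVSquareFamily_of_display (h : AnalyticRankOneOnDVSquareFamily') :
    AnalyticRankOneOnDVSquareFamily :=
  fun _ hD _ => h hD

/-- **On `F²` the s-case is exactly crux B's content**: granted the Dasgupta–Voight fact, the
ATTACKED conjunct `AnalyticRankOneOfRankOneFiniteShaThree` (crux B) alone yields the s-case on `F²`
— `rank E_D(ℚ) = 1` (DV) and `corank_{ℤ₃} Sel_{3^∞}(E_D) = 1` give `corank Ш(E_D)[3^∞] = 0` by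
Greenberg's identity (`selmerCorank_eq_mordellWeilRank_add_holds`), i.e. `#Ш(E_D)[3^∞] < ∞`
(`finite_primaryComponent_sha_iff_shaCorank_eq_zero`), and crux B returns `ord_{s=1} L(E_D, s) = 1`.
So the residual crux A carries no weight on `F²`: the separation in logical form. -/
theorem analyticRankOneOnDVSquareFamily_of_cruxB_of_dv
    (hDV : thm2_mordellWeilRank_eq_one_cubeSum_prime_and_sq)
    (hB : AnalyticRankOneOfRankOneFiniteShaThree) : AnalyticRankOneOnDVSquareFamily := by
  intro D hD hc
  haveI := isElliptic_mordellCurve hD.ne_zero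
  haveI : Fact (Nat.Prime 3) := ⟨Nat.prime_three⟩
  have hrank := hD.mordellWeilRank_eq_one hDV
  have hadd := (mordellCurve D).selmerCorank_eq_mordellWeilRank_add_holds 3
  have hsha : (mordellCurve D).shaCorank 3 = 0 := by omega
  exact hB hD.ne_zero hrank ((finite_primaryComponent_sha_iff_shaCorank_eq_zero _ 3).2 hsha)

end Summit.BirchSwinnertonDyer.BirchSwinnertonDyer.Theorems.MordellShaFreeCutDefs

/-! ## Appendix (same seat, same session): the plan's kit identifiers (plan g11,
`HOME/bsd-cn100-plan/routes-g11/kit/MordellShaFreeCutDefs.lean`, 2026-08-26T05:04Z) merged in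

Added VERBATIM from the kit (names unchanged, so the planner's intended fit edit
`tribunal_fit.s_case := …Theorems.MordellShaFreeCutDefs.RefinedPConverseSupersingularOnMordell` works):
* `RefinedPConverseSupersingularOnMordell` — Burungale–Kobayashi–Ota 2024 display (1.6) / Rem. 1.6 (ii)
  (OPEN) on Mordell curves at a good supersingular prime `p ≥ 5`, `p ≡ 2 (mod 3)`, `p ∤ D`: the rung
  leaf's analogue in the regime of the landed BC5 rung `MordellShaFreeCutRungSupersingular.stub_rung_supersingular`
  — the judge's «informative S-case» (verdict bsd-trib-j-1, 2026-08-26);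
* `coeff_sq_ne_zero`, `three_not_in_refined_regime`;
* the kit's EXPLICIT-BINDER displays of the witness / s-case on `F²` in the REGISTERED spelling
  `mordellCurve (−(432·p⁴))` — here named `RankPosOnDVSquareFamilyDisplay` (= VERBATIM the statement of
  the stub `stub_rung_dvSquare` registered on stmt-19159) and `AnalyticRankOneOnDVSquareFamilyDisplay`
  (the kit called them `RankPosOnDVSquareFamily` / `AnalyticRankOneOnDVSquareFamily`, names this file
  had already given to the `IsDVSquareFamily`-quantified forms above) — with the equivalences
  `rankPosOnDVSquareFamily_iff_display`, `analyticRankOneOnDVSquareFamily_iff_display` (the curves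
  `mordellCurve (−(432·(p²)²))` and `mordellCurve (−(432·p⁴))` are equal, the rung file's `MordellShaFreeCutRungDVSquare.mordellCurve_dvSquare_eq`, imported),
  and `…Display_of_crux` / `…Display_of_leaf`. Nothing asserted. -/

namespace Summit.BirchSwinnertonDyer.BirchSwinnertonDyer.Theorems.MordellShaFreeCutDefs

open Literature.NumberTheory.EllipticCurves
open Literature.NumberTheory.EllipticCurves.DasguptaVoight2018
open Summit.BirchSwinnertonDyer.BirchSwinnertonDyer.Theses.MordellShaFreeCut
open WeierstrassCurve

/-- The displayed coefficient `−432 p⁴` of `E_{p²}` is non-zero for a prime `p`. [folklore] -/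
theorem coeff_sq_ne_zero {p : ℕ} (hp : p.Prime) : (-(432 * (p : ℚ) ^ 4)) ≠ 0 := by
  have : (p : ℚ) ≠ 0 := by exact_mod_cast hp.ne_zero
  exact neg_ne_zero.mpr (mul_ne_zero (by norm_num) (pow_ne_zero 4 this))

/-- Membership of the registered-spelling parameter: `−432 p⁴ ∈ F²` for a prime `p ≡ 4, 7 (mod 9)` with
`3` not a cube mod `p`. -/
theorem IsDVSquareFamily.of_pow_four {p : ℕ} (hp : p.Prime) (h9 : p % 9 = 4 ∨ p % 9 = 7)
    (h3 : ¬ ∃ x : ZMod p, x ^ 3 = 3) : IsDVSquareFamily (-(432 * (p : ℚ) ^ 4)) :=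
  ⟨p, hp, h9, h3, by ring⟩

/-- **Kit display of the WITNESS** = VERBATIM the statement of the stub `stub_rung_dvSquare` registered on
stmt-BirchSwinnertonDyer-19159 (plan g11, 2026-08-26): for a prime `p ≡ 4, 7 (mod 9)` with `3` a
non-cube mod `p`, `corank_{ℤ₃} Sel_{3^∞}(E_{p²}/ℚ) = 1 ⟹ rank E_{p²}(ℚ) ≥ 1`, `E_{p²} = mordellCurve (−432 p⁴)`.
A theorem modulo Dasgupta–Voight 2018 Thm. 2 (`…RungDVSquare.rung_dvSquare_pow_four`); nothing asserted here.
[cite: DasguptaVoight2018, Thm. 2 (arXiv:1707.05874 p. 3)] -/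
@[conjecture] def RankPosOnDVSquareFamilyDisplay : Prop :=
  ∀ ⦃p : ℕ⦄, p.Prime → (p % 9 = 4 ∨ p % 9 = 7) → (¬ ∃ x : ZMod p, x ^ 3 = 3) →
    (mordellCurve (-(432 * (p : ℚ) ^ 4))).selmerCorank 3 = 1 →
      1 ≤ (mordellCurve (-(432 * (p : ℚ) ^ 4))).mordellWeilRank

/-- **Kit display of the S-CASE** (OPEN in refereed print): for a prime `p ≡ 4, 7 (mod 9)` with `3` a
non-cube mod `p`, `corank_{ℤ₃} Sel_{3^∞}(E_{p²}/ℚ) = 1 ⟹ ord_{s=1} L(E_{p²}, s) = 1`. Not in refereed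
print (Dasgupta–Voight 2018 §1.3; Hu–Shu–Yin 2019 Thm. 1.3 is `E_p` only); claimed in Yin 2026 (arXiv);
derivability caveat in `HOME/bsd-cn100-s2b-c3/SEPARATING-19159.md` §3.
[cite: DasguptaVoight2018, §1.3] [cite: HuShuYin2019, Thm. 1.3 (arXiv:1708.05266 p. 3)] -/
@[conjecture] def AnalyticRankOneOnDVSquareFamilyDisplay : Prop :=
  ∀ ⦃p : ℕ⦄, p.Prime → (p % 9 = 4 ∨ p % 9 = 7) → (¬ ∃ x : ZMod p, x ^ 3 = 3) →
    (mordellCurve (-(432 * (p : ℚ) ^ 4))).selmerCorank 3 = 1 →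
      (mordellCurve (-(432 * (p : ℚ) ^ 4))).analyticRank = 1

/-- **Burungale–Kobayashi–Ota 2024, display (1.6) / Remark 1.6 (ii), on Mordell curves at a good
supersingular prime** (OPEN): for `D ∈ ℤ ∖ {0}` and a prime `p ≥ 5`, `p ≡ 2 (mod 3)`, `p ∤ D`
(so `E_D : y² = x³ + D` has good supersingular reduction at `p`), `corank_{ℤ_p} Sel_{p^∞}(E_D/ℚ) = 1
⟹ ord_{s=1} L(E_D, s) = 1` — the refined converse WITHOUT the hypothesis `#Ш(E_D)[p^∞] < ∞` of
Thm. 1.5. This is the rung leaf's analogue in the regime of the landed BC5 rung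
`MordellShaFreeCutRungSupersingular.stub_rung_supersingular` (the informative S-case); BKO Rem. 1.6
(ii): "One may seek a refined `p`-converse […] (1.6)". Nothing asserted. (Plan g11 kit, verbatim.)
[cite: BurungaleKobayashiOta2023, Rem. 1.6 (ii) and display (1.6) (p. 1422)] -/
@[conjecture] def RefinedPConverseSupersingularOnMordell : Prop :=
  ∀ ⦃D : ℤ⦄, D ≠ 0 → ∀ ⦃p : ℕ⦄, p.Prime → 5 ≤ p → p % 3 = 2 → ¬ (p : ℤ) ∣ D →
    (mordellCurve (D : ℚ)).selmerCorank p = 1 → (mordellCurve (D : ℚ)).analyticRank = 1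

/-- The refined supersingular converse on Mordell curves excludes `p = 3` (the leaf's prime): the two
S-cases are about disjoint primes. (Plan g11 kit, verbatim.) [folklore] -/
theorem three_not_in_refined_regime {p : ℕ} (hp5 : 5 ≤ p) : p ≠ 3 := by omega

/-- The family form and the kit display of the WITNESS are equivalent (pure logic + `−432(p²)² = −432p⁴`). -/
theorem rankPosOnDVSquareFamily_iff_display :
    RankPosOnDVSquareFamily ↔ RankPosOnDVSquareFamilyDisplay := by
  constructor
  · intro h p hp h9 h3 hc
    exact h (IsDVSquareFamily.of_pow_four hp h9 h3) hc
  · intro h D hD hc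
    obtain ⟨p, hp, h9, h3, rfl⟩ := hD
    rw [MordellShaFreeCutRungDVSquare.mordellCurve_dvSquare_eq] at hc ⊢
    exact h hp h9 h3 hc

/-- The family form and the kit display of the S-CASE are equivalent (pure logic + `−432(p²)² = −432p⁴`). -/
theorem analyticRankOneOnDVSquareFamily_iff_display :
    AnalyticRankOneOnDVSquareFamily ↔ AnalyticRankOneOnDVSquareFamilyDisplay := by
  constructor
  · intro h p hp h9 h3 hc
    exact h (IsDVSquareFamily.of_pow_four hp h9 h3) hc
  · intro h D hD hc
    obtain ⟨p, hp, h9, h3, rfl⟩ := hD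
    rw [MordellShaFreeCutRungDVSquare.mordellCurve_dvSquare_eq] at hc ⊢
    exact h hp h9 h3 hc

/-- The kit display of the witness is an instance of crux A. (Plan g11 kit.) [folklore] -/
theorem rankPosOnDVSquareFamilyDisplay_of_crux (hA : RankPosOfThreeSelmerCorankOne) :
    RankPosOnDVSquareFamilyDisplay :=
  fun _ hp _ _ hSel => hA (coeff_sq_ne_zero hp) hSel

/-- The kit display of the witness, PROVED modulo the DV fact (registered-spelling twin of
`rankPosOnDVSquareFamily_of_dv`). -/
theorem rankPosOnDVSquareFamilyDisplay_of_dv (hDV : thm2_mordellWeilRank_eq_one_cubeSum_prime_and_sq) :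
    RankPosOnDVSquareFamilyDisplay :=
  rankPosOnDVSquareFamily_iff_display.1 (rankPosOnDVSquareFamily_of_dv hDV)

/-- The kit display of the S-case is an instance of the leaf. (Plan g11 kit.) [folklore] -/
theorem analyticRankOneOnDVSquareFamilyDisplay_of_leaf (hT : rankOne_threeConverse_mordellCurve) :
    AnalyticRankOneOnDVSquareFamilyDisplay :=
  fun _ hp _ _ hSel => hT (coeff_sq_ne_zero hp) hSel

end Summit.BirchSwinnertonDyer.BirchSwinnertonDyer.Theorems.MordellShaFreeCutDefs

/-! ## Appendix 2 (same seat, same session): NON-VACUITY on `F²` in family form (modulo Satgé 1986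
Thm. 2.9 for `D = p²`, `satge_selmerCorank_three_le_one_cubeSum_sq_of_prime_mod_nine`, and
Dasgupta–Voight 2018 Thm. 2) — the crux's hypothesis `corank_{ℤ₃} Sel_{3^∞} = 1` HOLDS on `F²`, so the
two displays of the S-case agree (`analyticRankOneOnDVSquareFamily_iff`, twin of
`CongruentShaFreeCutDefs.analyticRankOneOnMonskyUncovered_iff`), and `#Ш[3^∞] < ∞` there. -/

namespace Summit.BirchSwinnertonDyer.BirchSwinnertonDyer.Theorems.MordellShaFreeCutDefs

open Literature.NumberTheory.EllipticCurves
open Literature.NumberTheory.EllipticCurves.DasguptaVoight2018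
open Summit.BirchSwinnertonDyer.BirchSwinnertonDyer.Theses.MordellShaFreeCut
open WeierstrassCurve

/-- **On `F²` the crux's hypothesis HOLDS** — `corank_{ℤ₃} Sel_{3^∞}(E_D/ℚ) = 1` for `D ∈ F²`
(Satgé's `3`-descent for `D = p²`, `hS`; Dasgupta–Voight's `rank = 1`, `hDV`; Greenberg's identity):
the rung is non-vacuous. [cite: Satge1986, Thm. 2.9 (p. 312), case (2)] [cite: DasguptaVoight2018, Thm. 2] -/
theorem IsDVSquareFamily.selmerCorank_three_eq_one
    (hS : satge_selmerCorank_three_le_one_cubeSum_sq_of_prime_mod_nine)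
    (hDV : thm2_mordellWeilRank_eq_one_cubeSum_prime_and_sq) {D : ℚ} (h : IsDVSquareFamily D) :
    (mordellCurve D).selmerCorank 3 = 1 := by
  obtain ⟨p, hp, h9, h3, rfl⟩ := h
  exact MordellShaFreeCutRungDVSquare.selmerCorank_three_eq_one_dvSquare hS hDV hp h9 h3

/-- **`#Ш(E_D/ℚ)[3^∞] < ∞` for `D ∈ F²`** (modulo `hS`, `hDV`; corank identity): on `F²` both
hypotheses of crux B hold in print. [cite: Satge1986, Thm. 2.9 (p. 312), case (2)] [cite: DasguptaVoight2018, Thm. 2] -/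
theorem IsDVSquareFamily.finite_sha_three
    (hS : satge_selmerCorank_three_le_one_cubeSum_sq_of_prime_mod_nine)
    (hDV : thm2_mordellWeilRank_eq_one_cubeSum_prime_and_sq) {D : ℚ} (h : IsDVSquareFamily D) :
    Finite (AddCommGroup.primaryComponent (mordellCurve D).sha 3) := by
  obtain ⟨p, hp, h9, h3, rfl⟩ := h
  exact MordellShaFreeCutRungDVSquare.finite_sha_three_dvSquare hS hDV hp h9 h3

/-- The two displays of the S-case agree modulo the two refereed facts (the corank hypothesis holds
on `F²`). -/
theorem analyticRankOneOnDVSquareFamily_iff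
    (hS : satge_selmerCorank_three_le_one_cubeSum_sq_of_prime_mod_nine)
    (hDV : thm2_mordellWeilRank_eq_one_cubeSum_prime_and_sq) :
    AnalyticRankOneOnDVSquareFamily ↔ AnalyticRankOneOnDVSquareFamily' :=
  ⟨fun h _ hD => h hD (hD.selmerCorank_three_eq_one hS hDV), fun h _ hD _ => h hD⟩

/-- **Crux B alone gives the hypothesis-free display on `F²`** (modulo `hS`, `hDV`): granted the
ATTACKED conjunct `AnalyticRankOneOfRankOneFiniteShaThree`, `ord_{s=1} L(E_D, s) = 1` for every
`D ∈ F²` — B's hypotheses (`rank = 1`, `#Ш[3^∞] < ∞`) hold there in print; the residual A is idle on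
`F²`, and the unprinted `L`-side of `F²` is exactly an instance of B. -/
theorem analyticRankOneOnDVSquareFamily'_of_cruxB
    (hS : satge_selmerCorank_three_le_one_cubeSum_sq_of_prime_mod_nine)
    (hDV : thm2_mordellWeilRank_eq_one_cubeSum_prime_and_sq)
    (hB : AnalyticRankOneOfRankOneFiniteShaThree) : AnalyticRankOneOnDVSquareFamily' := by
  intro D hD
  obtain ⟨p, hp, h9, h3, rfl⟩ := hD
  exact MordellShaFreeCutRungDVSquare.analyticRank_eq_one_dvSquare_of_cruxB hS hDV hB hp h9 h3

end Summit.BirchSwinnertonDyer.BirchSwinnertonDyer.Theorems.MordellShaFreeCutDefs
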